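import Mathlib
import Summits.Langlands.Langlands.Theorems.PhantomRMYoshidaStableYoshidaCongruenceSwitchToModularSurface
import Literature.NumberTheory.GaloisRepresentations.SerreWeight
import Literature.NumberTheory.GaloisRepresentations.ResidualPairIntegrality
import HarnessLib

/-!
# Route `PhantomRMYoshida`, crux `StableYoshidaCongruence` (stmt-Langlands-13640), line
# `burkhardt-weddle-two-three-anchor`: Stub 3 `stub_localConditionsTransfer`

For an `𝔽_p`-model `ρb : Γ_ℚ → GL₄(𝔽_p)` of `σ ⊕ σ'` (LTWS `IsModelOf`: `ρb ⊗ k` is `GL₄(k)`-conjugate to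
the block sum), the two LOCAL side conditions of arXiv:2502.20645 Lemma 9.4.2 pass from the constituents
`σ, σ'` to the model:

* (a) at any finite place `v`, if `σ|Γ_{ℚ_v}` and `σ'|Γ_{ℚ_v}` are peu ramifiées (tree
  `ModPGaloisRep.IsPeuRamifie`: the upper ramification groups `I^u`, `u > 1`, lie in the kernel) then so is
  `ρb|Γ_{ℚ_v}`;
* (b) at any finite place `v`, if `σ, σ'` are unramified at `v` and some Frobenius polynomials `P₁, P₂` of
  `σ, σ'` at `v` have `P₁ P₂ ≠ (X² ± X + 2)²`, then `ρb` is unramified at `v` and every Frobenius polynomial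
  `Q` of `ρb` at `v` differs from `(X² ± X + 2)²` (LTWS `IsSwitchableAtTwo p v ρb`).

Proof.  Both are kernel statements plus characteristic-polynomial bookkeeping.  The kernel of `ρb` is the
intersection of the kernels of `σ` and `σ'` (`apply_eq_one_of_isModelOf`: from the model identity
`h⁻¹ (ρb ⊗ k)(τ) h = σ(τ) ⊕ σ'(τ) = 1` and injectivity of `GL₄(𝔽_p) → GL₄(k)`,
`FramedRep.baseChange_apply_eq_one_iff`), which gives (a) and the unramifiedness in (b).  For the Frobenius
polynomials: pick a prime `𝔓 ∣ v` of `ℤ̄` and an arithmetic Frobenius `g` at it (`primesAbove_nonempty`,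
`exists_isArithFrobAt_of_mem_primesAbove_holds`); then `Q = charpoly ρb(g)`, `Pᵢ = charpoly σ(g), charpoly σ'(g)`
and `charpoly ρb(g) ↦ charpoly σ(g) · charpoly σ'(g)` under `𝔽_p → k` (`IsModelOf.charpoly_map`), so
`Q = (X² ± X + 2)²` would force `P₁ P₂ = (X² ± X + 2)²` in `k[X]`.

Everything used is proved in the tree (the LTWS Stub-2 module and `ResidualPairIntegrality`); no named fact
is taken as a hypothesis.  Worker of lead prover-line-stmt-Langlands-13640-c1-0 (2026-08-16).
-/

-- `Summit.Langlands.Langlands.…` (summit = sub-problem name, D-0017 layout) trips `dupNamespace` on every decl.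
set_option linter.dupNamespace false

noncomputable section

open Polynomial IsDedekindDomain
open scoped NumberField
open Literature.NumberTheory.GaloisRepresentations
open Summit.Langlands.Langlands.Cruxes.StableYoshidaCongruence.LevelThreeWeierstrassSwitch

namespace Summit.Langlands.Langlands.Cruxes.StableYoshidaCongruence.BurkhardtWeddleTwoThreeAnchor

/-! ## The exceptional quartics under extension of scalars -/

/-- The two exceptional quartics `(X² ± X + 2)²` of arXiv:2502.20645 Thm 9.5.2 (2) over `𝔽_p` map to the
same quartics over `k` (spelled with `C 2`, as in the sector). -/
theorem map_exceptional_quartic {p : ℕ} {k : Type} [Field k] [CharP k p] (ε : ℤ) :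
    (((X ^ 2 + (ε : Polynomial (ZMod p)) * X + 2) ^ 2).map (ZMod.castHom (dvd_refl p) k)) =
      (X ^ 2 + (ε : Polynomial k) * X + C 2) ^ 2 := by
  simp only [Polynomial.map_pow, Polynomial.map_add, Polynomial.map_mul, Polynomial.map_X,
    Polynomial.map_intCast, Polynomial.map_ofNat]
  rw [show (C 2 : Polynomial k) = 2 from map_ofNat C 2]

/-! ## The kernel of the model -/

section Model

variable {p : ℕ} [Fact p.Prime] {k : Type} [Field k] [CharP k p] [TopologicalSpace k]
  [DiscreteTopology k]

omit [DiscreteTopology k] in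
/-- If `ρb ⊗ k` is conjugate to `σ ⊕ σ'` and `σ(τ) = 1`, `σ'(τ) = 1`, then `ρb(τ) = 1` (converse of
`IsModelOf.apply_eq_one`: `h⁻¹ (ρb ⊗ k)(τ) h = 1 ⊕ 1 = 1` and `GL₄(𝔽_p) → GL₄(k)` is injective). -/
theorem apply_eq_one_of_isModelOf {ρb : FramedGaloisRep ℚ (ZMod p) 4}
    {σ σ' : FramedGaloisRep ℚ k 2} (h : IsModelOf ρb σ σ') {τ : Field.absoluteGaloisGroup ℚ}
    (hσ : σ τ = 1) (hσ' : σ' τ = 1) : ρb τ = 1 := by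
  obtain ⟨h, hh⟩ := h
  have h2 := hh τ
  rw [hσ, hσ', Units.val_one, Matrix.fromBlocks_one, Matrix.reindex_apply,
    Matrix.submatrix_one_equiv, Units.val_eq_one] at h2
  have h1 : toK p k ρb τ = 1 := by
    have h3 : h * (h⁻¹ * toK p k ρb τ * h) * h⁻¹ = h * 1 * h⁻¹ := by rw [h2]
    simpa [mul_assoc] using h3
  exact (FramedRep.baseChange_apply_eq_one_iff (ZMod.castHom (dvd_refl p) k)
    continuous_of_discreteTopology (ZMod.castHom (dvd_refl p) k).injective ρb τ).1 h1

omit [DiscreteTopology k] in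
/-- Unramifiedness passes from the constituents `σ`, `σ'` to the model `ρb` (converse of
`IsModelOf.isUnramifiedAt`). -/
theorem isUnramifiedAt_of_isModelOf {ρb : FramedGaloisRep ℚ (ZMod p) 4}
    {σ σ' : FramedGaloisRep ℚ k 2} (h : IsModelOf ρb σ σ') {v : HeightOneSpectrum (𝓞 ℚ)}
    (hσ : σ.IsUnramifiedAt v) (hσ' : σ'.IsUnramifiedAt v) : ρb.IsUnramifiedAt v :=
  fun 𝔓 h𝔓 τ hτ => apply_eq_one_of_isModelOf h (hσ 𝔓 h𝔓 τ hτ) (hσ' 𝔓 h𝔓 τ hτ)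

omit [DiscreteTopology k] in
/-- Peu-ramifiedness at `v` passes from `σ|Γ_{ℚ_v}`, `σ'|Γ_{ℚ_v}` to `ρb|Γ_{ℚ_v}` (a kernel condition on the
upper ramification groups `I^u`, `u > 1`). -/
theorem isPeuRamifie_toLocal_of_isModelOf {ρb : FramedGaloisRep ℚ (ZMod p) 4}
    {σ σ' : FramedGaloisRep ℚ k 2} (h : IsModelOf ρb σ σ') {v : HeightOneSpectrum (𝓞 ℚ)}
    (hσ : ModPGaloisRep.IsPeuRamifie (σ.toLocal v)) (hσ' : ModPGaloisRep.IsPeuRamifie (σ'.toLocal v)) :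
    ModPGaloisRep.IsPeuRamifie (ρb.toLocal v) :=
  fun u hu τ hτ => apply_eq_one_of_isModelOf h (hσ u hu τ hτ) (hσ' u hu τ hτ)

omit [DiscreteTopology k] in
/-- The conditions at `2` pass from `(σ, σ')` to the model: if `σ, σ'` are unramified at `v` and some
Frobenius polynomials `P₁, P₂` of `σ, σ'` at `v` have `P₁ P₂ ≠ (X² ± X + 2)²`, then `IsSwitchableAtTwo p v ρb`. -/
theorem isSwitchableAtTwo_of_isModelOf {ρb : FramedGaloisRep ℚ (ZMod p) 4}
    {σ σ' : FramedGaloisRep ℚ k 2} (h : IsModelOf ρb σ σ') {v : HeightOneSpectrum (𝓞 ℚ)}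
    (hσ : σ.IsUnramifiedAt v) (hσ' : σ'.IsUnramifiedAt v)
    (hP : ∃ P₁ P₂ : Polynomial k, σ.HasFrobCharpolyAt v P₁ ∧ σ'.HasFrobCharpolyAt v P₂ ∧
      P₁ * P₂ ≠ (X ^ 2 + X + C 2) ^ 2 ∧ P₁ * P₂ ≠ (X ^ 2 - X + C 2) ^ 2) :
    IsSwitchableAtTwo p v ρb := by
  obtain ⟨P₁, P₂, hP₁, hP₂, hne₁, hne₂⟩ := hP
  refine ⟨isUnramifiedAt_of_isModelOf h hσ hσ', fun Q hQ => ?_⟩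
  obtain ⟨𝔓, h𝔓⟩ := v.primesAbove_nonempty
  obtain ⟨g, hg⟩ := HeightOneSpectrum.exists_isArithFrobAt_of_mem_primesAbove_holds h𝔓
  have hmap : Q.map (ZMod.castHom (dvd_refl p) k) = P₁ * P₂ := by
    rw [← hQ 𝔓 h𝔓 g hg, h.charpoly_map, hP₁ 𝔓 h𝔓 g hg, hP₂ 𝔓 h𝔓 g hg]
  have h₁ := map_exceptional_quartic (p := p) (k := k) (1 : ℤ)
  have h₂ := map_exceptional_quartic (p := p) (k := k) (-1 : ℤ)
  simp only [Int.cast_one, one_mul, Int.cast_neg, neg_mul, ← sub_eq_add_neg] at h₁ h₂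
  refine ⟨fun hQ₁ => hne₁ ?_, fun hQ₂ => hne₂ ?_⟩
  · rw [← hmap, hQ₁, h₁]
  · rw [← hmap, hQ₂, h₂]

end Model

/-! ## The stub -/

/-- **Stub 3 (`stub_localConditionsTransfer`) — the registered signature.**  For an `𝔽_p`-model `ρb` of
`σ ⊕ σ'` (`IsModelOf`): (a) at any finite place `v`, if `σ|Γ_{ℚ_v}` and `σ'|Γ_{ℚ_v}` are peu ramifiées (tree
`ModPGaloisRep.IsPeuRamifie`: the upper ramification groups `I^u`, `u > 1`, act trivially) then so is
`ρb|Γ_{ℚ_v}`; (b) at any finite place `v`, if `σ, σ'` are unramified at `v` and SOME Frobenius polynomials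
`P₁, P₂` of `σ, σ'` at `v` have `P₁ P₂ ≠ (X² ± X + 2)²`, then `ρb` is unramified at `v` and EVERY Frobenius
polynomial `Q` of `ρb` at `v` differs from `(X² ± X + 2)²` (LTWS `IsSwitchableAtTwo p v ρb`).
Both are KERNEL statements plus charpoly bookkeeping: `ρb(τ) = 1 ⟺ σ(τ) = 1 ∧ σ'(τ) = 1`
(`apply_eq_one_of_isModelOf`), and `charpoly ρb(g) ↦ charpoly σ(g) · charpoly σ'(g)` under
`𝔽_p → k` (`IsModelOf.charpoly_map`) at an arithmetic Frobenius `g` at a prime above `v`.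
[cite: Serre1987, §2.4 (peu ramifié); BoxerCalegariGeePilloni2025, Thm. 9.5.2 (2) (arXiv:2502.20645)] -/
theorem stub_localConditionsTransfer :
    ∀ (p : ℕ) [Fact p.Prime] (k : Type) [Field k] [CharP k p]
      [TopologicalSpace k] [DiscreteTopology k] (σ σ' : FramedGaloisRep ℚ k 2)
      (ρb : FramedGaloisRep ℚ (ZMod p) 4), IsModelOf ρb σ σ' →
      (∀ v : HeightOneSpectrum (𝓞 ℚ),
        ModPGaloisRep.IsPeuRamifie (σ.toLocal v) → ModPGaloisRep.IsPeuRamifie (σ'.toLocal v) →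
          ModPGaloisRep.IsPeuRamifie (ρb.toLocal v)) ∧
      (∀ v : HeightOneSpectrum (𝓞 ℚ), σ.IsUnramifiedAt v → σ'.IsUnramifiedAt v →
        (∃ P₁ P₂ : Polynomial k, σ.HasFrobCharpolyAt v P₁ ∧ σ'.HasFrobCharpolyAt v P₂ ∧
          P₁ * P₂ ≠ (X ^ 2 + X + C 2) ^ 2 ∧ P₁ * P₂ ≠ (X ^ 2 - X + C 2) ^ 2) →
        IsSwitchableAtTwo p v ρb) :=
  fun _ _ _ _ _ _ _ _ _ _ h =>
    ⟨fun _ hσ hσ' => isPeuRamifie_toLocal_of_isModelOf h hσ hσ',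
      fun _ hσ hσ' hP => isSwitchableAtTwo_of_isModelOf h hσ hσ' hP⟩

end Summit.Langlands.Langlands.Cruxes.StableYoshidaCongruence.BurkhardtWeddleTwoThreeAnchor

end
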